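import Summits.QuantumFields.YangMills.Theorems.F4SubCurvatureDoorShortRootRigidityFlatDoubleEdge
import HarnessLib

/-!
# `stub_flatDoubleEdge` of LINE g21-C «aperture bootstrap» (crux ⟨stmt-QuantumFields-23035⟩ `ShortRootRigidity`) BY NAME AND SIGNATURE

Registered skeleton `Cruxes/ShortRootRigidity/Lines/aperture_bootstrap.lean` (planner ym-idea-3 g21, commit cba045e6138d, sha16 2f950b347c67e923;
critic idea-crit-4 g9 PASS A−), stub `:128 theorem stub_flatDoubleEdge : FlatDoubleEdge` (M; the local Bochner tube theorem for two flat
ℂ-independent half-spaces in `ℂ²` with the sup bound and gain linear in the radius).  The Prop is the CHARACTER-IDENTICAL restatement of the landed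
rung file `…ShortRootRigidityFlatDoubleEdge` (this seat, p723152; model case p722711), and the proof is that file's `flatDoubleEdge_holds`.

HONEST LABEL: one registered stub (M) of an OPEN line; `stub_planarApertureStep` (L, THE step), `stub_planarSpectralCone_of_coneSupport`,
`stub_oddModeRigidity`, (C), ⟨23035⟩, R2d and the Yang–Mills mass gap remain OPEN; no summit is proved by a line.  Lead seat `ym-line-sfw-p2` g75.
-/

set_option autoImplicit false

namespace Summit.QuantumFields.YangMills.Theorems.F4SubCurvatureDoorApertureBootstrapStubFlatDoubleEdge

open Summit.QuantumFields.YangMills.Theorems.F4SubCurvatureDoorFlatDoubleEdgeRegistered (FlatDoubleEdge flatDoubleEdge_holds)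

/-- **Registered stub `:128` of LINE g21-C, BY NAME AND SIGNATURE**: `FlatDoubleEdge`. -/
theorem stub_flatDoubleEdge : FlatDoubleEdge := flatDoubleEdge_holds

end Summit.QuantumFields.YangMills.Theorems.F4SubCurvatureDoorApertureBootstrapStubFlatDoubleEdge
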